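import Summits.QuantumFields.YangMills.Theorems.BalabanUVNodesN21ExpChartSharpRadius
import Mathlib.Data.Fin.Tuple.Sort

/-!
# N21 (NE7c) · THE COVERING RADIUS OF THE `SU(N)` EXPONENTIAL CHART: every `U ∈ SU(N)` is `expPtSU v` with `‖v‖_HS ≤ √N·π`
# (file 19: `(N+1)·√N·π`), and the central element `e^{2πik/N}·1` admits NO logarithm of norm `< 2π·√(k(N−k)/N)` — so for
# even `N` the radius `√N·π` is ATTAINED: the windows exhaust the group exactly at `S = √N·π`

Width seat pub-ymgap-dag-n21-w1 (g4; director-ym №197 ∕ HUMAN RULING D-0149), node N21 = NE7c (NOT PRINTED in [Bałaban 1983–89], NOT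
proved), lane K3⁸ `SpineGivenEndpointR13SepCoPHV` (stmt-QuantumFields-27366, KEY MAP v2; lineage K3⁷ stmt-QuantumFields-20544),
`--kind proof --supports … --as helper`.  File 27 of the seat's chain — the companion of files 23–26 (injectivity radius `√2·π`) on the
OTHER radius of the chart: how large a window must be to be the whole group.  Answers referee ref-O g10 READ-267's NIT on file 19 («the bound
`(N+1)√N·π` is loose»).  THEOREMS ONLY: 0 `def`, 0 `sorry`; count-neutral.  Imports file 23 (hence files 18–19 and pub-balaban's chart modules)
and `Mathlib.Data.Fin.Tuple.Sort` (`Tuple.sort`, `Tuple.monotone_sort`).  NO Theses import.  Restates nothing; cites by name.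

THE MATHEMATICS ([folklore]; the covering radius of the root lattice `A_{N−1}` in disguise).  Diagonalise `U = V·diag(λ)·V*`, principal angles
`θ_j = arg λ_j ∈ (−π, π]`, `x_j := θ_j/2π ∈ [−½, ½]`; `det U = 1` makes `Σ x_j = m ∈ ℤ`.  A trace-free logarithm is `2π(x + n)·i` in the frame `V`
for any `n ∈ ℤ^N` with `Σ n = −m`; file 19 took `n = −m·e₀` (one angle pays everything).  Instead (§1): add `+1` to the `|m|` SMALLEST
coordinates of `x` (or `−1` to the `m` largest): since sorted neighbours differ by `≤ 1` before and after, ALL pairwise differences of `y := x + n`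
are `≤ 1`, i.e. `y ∈ [a, a+1]^N` with `Σ y = 0`; then `Σ_j (y_j − a)(y_j − a − 1) ≤ 0` reads `Σ y² ≤ −N·a(a+1) ≤ N/4` (`sum_sq_le_card_div_four`).
Hence `‖v‖² = 4π²·Σ y² ≤ N·π²` (§2).  Conversely (§3) a logarithm of the central element `e^{2πik/N}·1` has all angles in `2πk/N + 2πℤ`:
`x_j = k/N + n_j`, `Σ n = −k`, and the integer inequality `(c + n)² ≥ c² + n(2c − 1)` (`⇔ n(n+1) ≥ 0`) sums to
`Σ x² ≥ N(k/N)² − (2k/N − 1)·k = k(N−k)/N`; at `N = 2k` this is `N/4`: the central element `−1 ∈ SU(2k)` needs `‖v‖ ≥ √N·π`.  (For odd `N` the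
exact covering radius is `2π·√(⌊N/2⌋⌈N/2⌉/N) = π·√(N − 1/N)`, between §3's lower bound and §2's `√N·π`; not pursued.)

WHAT IS PROVED ([folklore]).
* §1 `sum_sq_le_card_div_four` (the interval lemma) · `exists_shift_gaps_le_one` (`Tuple.sort`: `+1` on the `m` smallest coordinates keeps all gaps
  `≤ 1`) · ★ `exists_int_shift_sum_zero_sum_sq_le` (`|x_j| ≤ ½`, `Σ x ∈ ℤ ⇒ ∃ n ∈ ℤ^N`, `Σ(x+n) = 0`, `Σ(x+n)² ≤ N/4`).
* §2 ★★ `exists_expPtSU_eq_norm_le_sqrt_mul_pi` (`∀ U : SU(N), ∃ v, expPtSU v = U ∧ ‖v‖ ≤ √N·π`) · `expBallSU_sqrt_mul_pi_eq_univ` ·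
  `expWindowSU_sqrt_mul_pi_eq_univ` · `haar_expBallSU_sqrt_mul_pi` (mass `1`).
* §3 `sq_add_int_ge` (`(c+n)² ≥ c² + n(2c−1)`, `n ∈ ℤ`) · `conjDiag_const` · ★ `sq_norm_ge_of_expPtSU_eq_centre` (a logarithm of `e^{2πik/N}·1` has
  `‖v‖² ≥ (2π)²·k(N−k)/N`) · `centre_mem_specialUnitaryGroup` · ★★ `exists_forall_expPtSU_eq_sqrt_mul_pi_le_norm` (even `N ≥ 2`: some `U` has NO
  logarithm of norm `< √N·π`) · `expBallSU_ne_univ_of_lt_sqrt_mul_pi` (even `N ≥ 2`, `S < √N·π ⇒ expBallSU S ≠ SU(N)`): with §2 the covering radius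
  of the chart is EXACTLY `√N·π` for even `N`.

HONEST FRAMING.  [folklore] linear algebra (lattice bookkeeping + file 19's construction); no located letter of any N21 road is touched; types nothing of
Bałaban's; (M1) ∕ NE7c NOT PRINTED ∕ NOT proved; **N21 NOT discharged**; K3⁸ NOT claimed; counts unmoved (typed 28∕28 · discharged 5∕27); never a count
claim; one finite 𝕋⁴ at fixed ε — R4 would close only the conditional finite-𝕋⁴ rung `BalabanLadder.UV`, NOT the Yang–Mills mass gap (Clay); nothing about
ℝ⁴ ∕ OS.  No decl below carries a cite tag.
-/

set_option autoImplicit false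

noncomputable section

open scoped BigOperators ENNReal
open MeasureTheory Set Function Metric Matrix Finset
open Complex (I)

namespace Summit.QuantumFields.YangMills.Theorems.N21ExpChartCoveringRadius

open Literature.MathematicalPhysics.QuantumFieldTheory.Balaban1983to89
open Summit.QuantumFields.BalabanUV.T4Continuum
open Summit.QuantumFields.BalabanUV.T4Continuum.ShellMeasureExpChartSUN (SUN ChartSU genSU expPtSU coe_expPtSU)
open Summit.QuantumFields.BalabanUV.T4Continuum.ShellMeasureVandermondeSUN (conjDiag coe_mul_star_coe)
open Summit.QuantumFields.BalabanUV.T4Continuum.ShellMeasureExpJacobianSUN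
  (herm exists_conjDiag exp_genSU_eq_conjDiag norm_sq_eq_sum_sq)
open Summit.QuantumFields.BalabanUV.T4Continuum.UnitaryResolventMargin (exists_conjDiag_of_unitary)
open Summit.QuantumFields.BalabanUV.T4Continuum.ShellMeasureScalingSUN (expBallSU expWindowSU)
open Summit.QuantumFields.BalabanUV.T4Continuum.ShellMeasureExpHaarClosedBallSUN (sum_eigen_eq_zero)
open Summit.QuantumFields.YangMills.Theorems.N21ExpWindowHaarMassLtOne (det_conjDiag)
open Summit.QuantumFields.YangMills.Theorems.N21ExpChartSurjective (cexp_arg_mul_I_of_norm_eq_one exists_herm_eq_conjDiag)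
open Summit.QuantumFields.YangMills.Theorems.N21ExpChartSharpRadius (conjDiag_injective)

variable {N : ℕ}

/-! ## §1 The lattice step: shift by integers with zero sum into an interval of length one -/

section Lattice

/-- **THE INTERVAL LEMMA**: `y_j ∈ [a, a+1]` for all `j` and `Σ y = 0` imply `Σ y² ≤ N/4` (`Σ (y_j − a)(y_j − a − 1) ≤ 0`). [folklore] -/
theorem sum_sq_le_card_div_four {ι : Type*} [Fintype ι] {y : ι → ℝ} {a : ℝ} (hy : ∀ j, a ≤ y j ∧ y j ≤ a + 1)
    (hsum : ∑ j, y j = 0) : ∑ j, y j ^ 2 ≤ (Fintype.card ι : ℝ) / 4 := by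
  have h1 : ∑ j, (y j - a) * (y j - (a + 1)) ≤ 0 :=
    sum_nonpos fun j _ => mul_nonpos_of_nonneg_of_nonpos (by linarith [hy j]) (by linarith [hy j])
  have h2 : ∑ j, (y j - a) * (y j - (a + 1)) = ∑ j, y j ^ 2 - (2 * a + 1) * ∑ j, y j + Fintype.card ι * (a * (a + 1)) := by
    rw [mul_sum, ← sum_sub_distrib, ← card_univ, ← nsmul_eq_mul, ← sum_const, ← sum_add_distrib]
    exact sum_congr rfl fun j _ => by ring
  rw [h2, hsum, mul_zero, sub_zero] at h1
  nlinarith [sq_nonneg (2 * a + 1), (Nat.cast_nonneg (Fintype.card ι) : (0 : ℝ) ≤ Fintype.card ι)]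

/-- **THE SHIFT**: for `|x_j| ≤ ½` and `m ≤ N`, adding `1` to `m` SMALLEST coordinates (a `Tuple.sort`-initial segment) produces `y = x + n`,
`n ∈ {0,1}^N`, `Σ n = m`, with ALL pairwise differences `y_i − y_j ≤ 1`. [folklore] -/
theorem exists_shift_gaps_le_one (x : Fin N → ℝ) (hx : ∀ j, |x j| ≤ 1 / 2) {m : ℕ} (hm : m ≤ N) :
    ∃ n : Fin N → ℤ, ∑ j, (n j : ℝ) = m ∧ ∀ i j, x i + n i - (x j + n j) ≤ 1 := by
  classical
  let σ : Equiv.Perm (Fin N) := Tuple.sort x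
  have hmono : Monotone (x ∘ σ) := Tuple.monotone_sort x
  let S : Finset (Fin N) := (univ.filter fun k : Fin N => (k : ℕ) < m).image σ
  have hS : ∀ i, i ∈ S ↔ ((σ.symm i : Fin N) : ℕ) < m := fun i => by
    constructor
    · rintro hi
      obtain ⟨k, hk, rfl⟩ := mem_image.mp hi
      rw [Equiv.symm_apply_apply]
      exact (mem_filter.mp hk).2
    · intro hi
      exact mem_image.mpr ⟨σ.symm i, mem_filter.mpr ⟨mem_univ _, hi⟩, Equiv.apply_symm_apply _ _⟩
  have hcard : S.card = m := by
    rw [card_image_of_injective _ σ.injective, Fin.card_filter_val_lt, min_eq_right hm]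
  refine ⟨fun i => if i ∈ S then 1 else 0, ?_, fun i j => ?_⟩
  · rw [show (∑ j, ((if j ∈ S then (1 : ℤ) else 0 : ℤ) : ℝ)) = ∑ j, (if j ∈ S then (1 : ℝ) else 0) from
        sum_congr rfl fun j _ => by split_ifs <;> simp, sum_boole, ← hcard]
    simp
  · have hxi := abs_le.mp (hx i)
    have hxj := abs_le.mp (hx j)
    by_cases hi : i ∈ S <;> by_cases hj : j ∈ S <;> simp only [hi, hj, if_true, if_false, Int.cast_one, Int.cast_zero]
    · linarith
    · -- `i` shifted, `j` not: `x i ≤ x j` by the sort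
      have hki : ((σ.symm i : Fin N) : ℕ) < m := (hS i).mp hi
      have hkj : ¬ ((σ.symm j : Fin N) : ℕ) < m := fun h => hj ((hS j).mpr h)
      have hle : σ.symm i ≤ σ.symm j := Fin.le_def.mpr (by omega)
      have hxle : x i ≤ x j := by
        have := hmono hle
        simpa only [Function.comp_apply, Equiv.apply_symm_apply] using this
      linarith
    · linarith
    · linarith

/-- ★ **THE LATTICE STEP**: for `|x_j| ≤ ½` with `Σ x = m ∈ ℤ` there is `n ∈ ℤ^N` with `Σ (x + n) = 0` and `Σ (x + n)² ≤ N/4` — the closest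
point of the coset `x + {n ∈ ℤ^N | Σ n = −m}` lies in the cube of half-width… no: in an INTERVAL `[a, a+1]^N` (§1's shift on `±x`), and the
interval lemma bounds its norm. [folklore] -/
theorem exists_int_shift_sum_zero_sum_sq_le (x : Fin N → ℝ) (hx : ∀ j, |x j| ≤ 1 / 2) {m : ℤ} (hm : ∑ j, x j = m) :
    ∃ n : Fin N → ℤ, ∑ j, (x j + n j) = 0 ∧ ∑ j, (x j + n j) ^ 2 ≤ (N : ℝ) / 4 := by
  -- `|m| ≤ N/2 ≤ N`
  have hmabs : |(m : ℝ)| ≤ N / 2 := by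
    rw [← hm]
    calc |∑ j, x j| ≤ ∑ j, |x j| := abs_sum_le_sum_abs _ _
      _ ≤ ∑ _j : Fin N, (1 / 2 : ℝ) := sum_le_sum fun j _ => hx j
      _ = N / 2 := by rw [sum_const, card_univ, Fintype.card_fin, nsmul_eq_mul]; ring
  have hN0 : (0 : ℝ) ≤ N := Nat.cast_nonneg N
  -- a shift with zero sum and all gaps `≤ 1`
  obtain ⟨n, hn0, hgap⟩ : ∃ n : Fin N → ℤ, ∑ j, (x j + n j) = 0 ∧ ∀ i j, x i + n i - (x j + n j) ≤ 1 := by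
    rcases le_or_gt m 0 with hm0 | hm0
    · -- `m ≤ 0`: add `+1` to the `|m|` smallest coordinates of `x`
      have h4 : (m.natAbs : ℝ) = -(m : ℝ) := by
        rw [Nat.cast_natAbs, Int.cast_abs, abs_of_nonpos (by exact_mod_cast hm0 : (m : ℝ) ≤ 0)]
      have hle : m.natAbs ≤ N := by
        have h2 : (m.natAbs : ℝ) ≤ N := by
          have := (abs_le.mp hmabs).1
          linarith
        exact_mod_cast h2
      obtain ⟨n, hn, hgap⟩ := exists_shift_gaps_le_one x hx hle
      refine ⟨n, ?_, hgap⟩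
      rw [sum_add_distrib, hm, hn]
      linarith
    · -- `m > 0`: add `+1` to the `m` smallest coordinates of `−x`, then negate
      have hle : m.toNat ≤ N := by
        have h1 : ((m.toNat : ℤ) : ℝ) = (m : ℝ) := by rw [Int.toNat_of_nonneg hm0.le]
        have h2 : (m.toNat : ℝ) ≤ N := by
          have := (abs_le.mp hmabs).2
          have h3 : (m.toNat : ℝ) = (m : ℝ) := by exact_mod_cast h1
          linarith
        exact_mod_cast h2
      obtain ⟨n, hn, hgap⟩ := exists_shift_gaps_le_one (fun j => -x j) (fun j => by rw [abs_neg]; exact hx j) hle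
      refine ⟨fun j => -n j, ?_, fun i j => ?_⟩
      · have h1 : ((m.toNat : ℤ) : ℝ) = (m : ℝ) := by rw [Int.toNat_of_nonneg hm0.le]
        have h3 : (m.toNat : ℝ) = (m : ℝ) := by exact_mod_cast h1
        have h5 : ∑ j, (x j + ((-n j : ℤ) : ℝ)) = ∑ j, x j - ∑ j, (n j : ℝ) := by
          rw [← sum_sub_distrib]
          exact sum_congr rfl fun j _ => by rw [Int.cast_neg]; ring
        rw [h5, hm, hn, h3, sub_self]
      · have := hgap j i
        simp only [Int.cast_neg]
        linarith
  -- all coordinates of `y = x + n` lie in `[a, a+1]`, `a` the minimum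
  rcases Nat.eq_zero_or_pos N with hN | hN
  · subst hN
    refine ⟨n, hn0, ?_⟩
    simp
  · haveI : Nonempty (Fin N) := ⟨⟨0, hN⟩⟩
    obtain ⟨j₀, hj₀⟩ := Finite.exists_min fun j => x j + n j
    refine ⟨n, hn0, ?_⟩
    have h := sum_sq_le_card_div_four (y := fun j => x j + n j) (a := x j₀ + n j₀)
      (fun j => ⟨hj₀ j, by linarith [hgap j j₀]⟩) hn0
    simpa only [Fintype.card_fin] using h

end Lattice

/-! ## §2 Every element of `SU(N)` is a chart point of norm `≤ √N·π` -/

section Cover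

/-- ★★ **EVERY ELEMENT OF `SU(N)` IS A CHART POINT OF HILBERT–SCHMIDT NORM `≤ √N·π`** (file 19's `exists_expPtSU_eq`: `(N+1)·√N·π`).
Diagonalise `U = V·diag(λ)·V*`, `x_j = arg λ_j / 2π ∈ [−½, ½]`, `Σ x = m ∈ ℤ` (`det U = 1`); §1 gives `n ∈ ℤ^N` with `Σ(x+n) = 0`,
`Σ(x+n)² ≤ N/4`; the angles `θ' = 2π(x + n)` are trace-free with `e^{iθ'} = λ` and `Σ θ'² ≤ N·π²`. [folklore] -/
theorem exists_expPtSU_eq_norm_le_sqrt_mul_pi (U : SUN N) :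
    ∃ v : ChartSU N, expPtSU v = U ∧ ‖v‖ ≤ Real.sqrt N * Real.pi := by
  obtain ⟨V, lam, hlam, hW0⟩ := exists_conjDiag_of_unitary (Matrix.mem_specialUnitaryGroup_iff.mp U.2).1
  have hW : (U : Matrix (Fin N) (Fin N) ℂ) = conjDiag V lam := hW0
  -- principal angles, in units of `2π`
  set θ : Fin N → ℝ := fun j => Complex.arg (lam j) with hθdef
  have hθlam : ∀ j, Complex.exp (θ j * I) = lam j := fun j => cexp_arg_mul_I_of_norm_eq_one (hlam j)
  set x : Fin N → ℝ := fun j => θ j / (2 * Real.pi) with hxdef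
  have hx : ∀ j, |x j| ≤ 1 / 2 := fun j => by
    have hθj : |θ j| ≤ Real.pi := Complex.abs_arg_le_pi (lam j)
    show |θ j / (2 * Real.pi)| ≤ 1 / 2
    rw [abs_div, abs_of_pos Real.two_pi_pos, div_le_iff₀ Real.two_pi_pos]
    linarith
  -- `det U = 1 ⇒ Σ θ = 2π m`
  have hdet : (U : Matrix (Fin N) (Fin N) ℂ).det = 1 := (Matrix.mem_specialUnitaryGroup_iff.mp U.2).2
  have hsum1 : Complex.exp (((∑ j, θ j : ℝ) : ℂ) * I) = 1 := by
    rw [hW, det_conjDiag] at hdet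
    rw [Complex.ofReal_sum, sum_mul, Complex.exp_sum]
    calc ∏ j, Complex.exp ((θ j : ℂ) * I) = ∏ j, lam j := prod_congr rfl fun j _ => hθlam j
      _ = 1 := hdet
  obtain ⟨m, hm⟩ := Complex.exp_eq_one_iff.mp hsum1
  have hsumθ : ∑ j, θ j = m * (2 * Real.pi) := by
    have := congrArg Complex.im hm
    simpa using this
  have hsumx : ∑ j, x j = m := by
    simp only [hxdef]
    rw [← sum_div, hsumθ, mul_div_assoc, div_self Real.two_pi_pos.ne', mul_one]
  -- the lattice step
  obtain ⟨n, hn0, hnsq⟩ := exists_int_shift_sum_zero_sum_sq_le x hx hsumx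
  set θ' : Fin N → ℝ := fun j => 2 * Real.pi * (x j + n j) with hθ'def
  have hsum0 : ∑ j, θ' j = 0 := by
    simp only [hθ'def]; rw [← mul_sum, hn0, mul_zero]
  have hθ'lam : ∀ j, Complex.exp (θ' j * I) = lam j := by
    intro j
    have h2 : 2 * Real.pi * (θ j / (2 * Real.pi)) = θ j := mul_div_cancel₀ _ Real.two_pi_pos.ne'
    have h0 : θ' j = θ j + n j * (2 * Real.pi) := by
      show 2 * Real.pi * (θ j / (2 * Real.pi) + n j) = θ j + n j * (2 * Real.pi)
      rw [mul_add, h2]; ring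
    have h1 : (θ' j : ℂ) * I = θ j * I + n j * (2 * Real.pi * I) := by
      rw [h0]; push_cast; ring
    rw [h1, Complex.exp_add, Complex.exp_int_mul_two_pi_mul_I, mul_one, hθlam]
  obtain ⟨v, hherm⟩ := exists_herm_eq_conjDiag V θ' hsum0
  refine ⟨v, ?_, ?_⟩
  · apply Subtype.ext
    rw [coe_expPtSU, exp_genSU_eq_conjDiag hherm, hW]
    congr 1
    funext j
    exact hθ'lam j
  · have hsq : ‖v‖ ^ 2 = (2 * Real.pi) ^ 2 * ∑ j, (x j + n j) ^ 2 := by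
      rw [norm_sq_eq_sum_sq hherm, mul_sum]
      exact sum_congr rfl fun j _ => by simp only [hθ'def]; ring
    have h0 : 0 ≤ Real.sqrt N * Real.pi := by positivity
    have hrhs : (Real.sqrt N * Real.pi) ^ 2 = N * Real.pi ^ 2 := by rw [mul_pow, Real.sq_sqrt (Nat.cast_nonneg N)]
    refine (pow_le_pow_iff_left₀ (norm_nonneg v) h0 two_ne_zero).mp ?_
    rw [hsq, hrhs]
    nlinarith [hnsq, Real.pi_pos]

/-- **THE WINDOW OF RADIUS `√N·π` IS THE WHOLE GROUP** (file 19: `(N+1)√N·π`). [folklore] -/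
theorem expBallSU_sqrt_mul_pi_eq_univ : expBallSU (N := N) (Real.sqrt N * Real.pi) = univ :=
  eq_univ_of_forall fun U => by
    obtain ⟨v, hv, hle⟩ := exists_expPtSU_eq_norm_le_sqrt_mul_pi U
    exact ⟨v, mem_closedBall_zero_iff.mpr hle, hv⟩

/-- … about every centre. [folklore] -/
theorem expWindowSU_sqrt_mul_pi_eq_univ (g : SUN N) : expWindowSU g (Real.sqrt N * Real.pi) = univ := by
  rw [expWindowSU, expBallSU_sqrt_mul_pi_eq_univ, image_univ]
  exact (Group.mulLeft_bijective g).surjective.range_eq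

variable [NeZero N] in
/-- … so its Haar mass is `1`. [folklore] -/
theorem haar_expBallSU_sqrt_mul_pi : (HaarData.haar : Measure (SUN N)) (expBallSU (Real.sqrt N * Real.pi)) = 1 := by
  haveI : IsProbabilityMeasure (HaarData.haar : Measure (SUN N)) := HaarData.isProb
  rw [expBallSU_sqrt_mul_pi_eq_univ, measure_univ]

end Cover

/-! ## §3 The centre: `e^{2πik/N}·1` has no logarithm of norm `< 2π·√(k(N−k)/N)`; at `N = 2k` the radius `√N·π` is attained -/

section Centre

/-- the integer inequality `(c + n)² ≥ c² + n(2c − 1)` (`⇔ n(n+1) ≥ 0`, `n ∈ ℤ`). [folklore] -/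
theorem sq_add_int_ge (c : ℝ) (n : ℤ) : c ^ 2 + n * (2 * c - 1) ≤ (c + n) ^ 2 := by
  have hn : (0 : ℝ) ≤ n * (n + 1) := by
    rcases le_or_gt 0 n with h | h
    · have h1 : (0 : ℝ) ≤ n := by exact_mod_cast h
      positivity
    · have h1 : (n : ℝ) + 1 ≤ 0 := by exact_mod_cast (Int.lt_iff_add_one_le.mp h)
      have h2 : (n : ℝ) ≤ 0 := by exact_mod_cast h.le
      exact mul_nonneg_of_nonpos_of_nonpos h2 h1
  nlinarith [hn]

/-- `U·diag(c, …, c)·U* = c·1`. [folklore] -/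
theorem conjDiag_const (U : Matrix.unitaryGroup (Fin N) ℂ) (c : ℂ) :
    conjDiag U (fun _ => c) = c • (1 : Matrix (Fin N) (Fin N) ℂ) := by
  unfold conjDiag
  rw [← Matrix.smul_one_eq_diagonal, Matrix.mul_smul, Matrix.mul_one, Matrix.smul_mul, coe_mul_star_coe]

/-- ★ **A LOGARITHM OF THE CENTRAL ELEMENT `e^{2πik/N}·1` HAS `‖v‖² ≥ (2π)²·k(N−k)/N`**: its angles lie in `2πk/N + 2πℤ` (same frame,
`conjDiag_injective`), are trace-free, and §3's integer inequality sums to the bound. [folklore] -/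
theorem sq_norm_ge_of_expPtSU_eq_centre (hN : 0 < N) {k : ℕ} {v : ChartSU N}
    (h : ((expPtSU v : SUN N) : Matrix (Fin N) (Fin N) ℂ) =
      Complex.exp ((((2 * Real.pi * k / N : ℝ)) : ℂ) * I) • (1 : Matrix (Fin N) (Fin N) ℂ)) :
    (2 * Real.pi) ^ 2 * ((k : ℝ) * (N - k) / N) ≤ ‖v‖ ^ 2 := by
  obtain ⟨U, θ, hθ⟩ := exists_conjDiag v
  set c : ℝ := 2 * Real.pi * k / N with hcdef
  -- every angle is `c` modulo `2π`
  have hexp : ∀ j, Complex.exp (θ j * I) = Complex.exp ((c : ℂ) * I) := by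
    have h1 : conjDiag U (fun j => Complex.exp (θ j * I)) = conjDiag U (fun _ => Complex.exp ((c : ℂ) * I)) := by
      rw [← exp_genSU_eq_conjDiag hθ, conjDiag_const, ← coe_expPtSU, h]
    exact fun j => congr_fun (conjDiag_injective U h1) j
  have hn : ∀ j, ∃ n : ℤ, θ j = c + n * (2 * Real.pi) := fun j => by
    obtain ⟨n, hn⟩ := Complex.exp_eq_exp_iff_exists_int.mp (hexp j)
    refine ⟨n, ?_⟩
    have := congrArg Complex.im hn
    simpa using this
  choose n hn using hn
  -- in units of `2π`: `θ_j / 2π = k/N + n_j`, `Σ n = −k`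
  have hNr : (0 : ℝ) < N := by exact_mod_cast hN
  have hsum : ∑ j, θ j = 0 := sum_eigen_eq_zero hθ
  have hsumn : ∑ j, (n j : ℝ) = -k := by
    have h1 : ∑ j, θ j = N * c + (∑ j, (n j : ℝ)) * (2 * Real.pi) := by
      rw [sum_congr rfl fun j _ => hn j, sum_add_distrib, sum_const, card_univ, Fintype.card_fin, nsmul_eq_mul, sum_mul]
    rw [hsum, hcdef] at h1
    field_simp at h1
    nlinarith [Real.pi_pos]
  have hsq : ‖v‖ ^ 2 = (2 * Real.pi) ^ 2 * ∑ j, ((k : ℝ) / N + n j) ^ 2 := by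
    rw [norm_sq_eq_sum_sq hθ, mul_sum]
    refine sum_congr rfl fun j _ => ?_
    rw [hn j, hcdef]
    ring
  rw [hsq]
  refine mul_le_mul_of_nonneg_left ?_ (sq_nonneg _)
  calc (k : ℝ) * (N - k) / N = N * ((k : ℝ) / N) ^ 2 + (-k) * (2 * ((k : ℝ) / N) - 1) := by
        field_simp; ring
    _ = ∑ j, (((k : ℝ) / N) ^ 2 + n j * (2 * ((k : ℝ) / N) - 1)) := by
        rw [sum_add_distrib, sum_const, card_univ, Fintype.card_fin, nsmul_eq_mul, ← sum_mul, hsumn]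
    _ ≤ ∑ j, ((k : ℝ) / N + n j) ^ 2 := sum_le_sum fun j _ => sq_add_int_ge _ _

/-- the central element `e^{2πik/N}·1` is special unitary (`|ζ| = 1`, `ζ^N = e^{2πik} = 1`). [folklore] -/
theorem centre_mem_specialUnitaryGroup (hN : 0 < N) (k : ℕ) :
    Complex.exp ((((2 * Real.pi * k / N : ℝ)) : ℂ) * I) • (1 : Matrix (Fin N) (Fin N) ℂ) ∈
      Matrix.specialUnitaryGroup (Fin N) ℂ := by
  set ζ : ℂ := Complex.exp ((((2 * Real.pi * k / N : ℝ)) : ℂ) * I) with hζ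
  have hζ1 : ‖ζ‖ = 1 := by rw [hζ, Complex.norm_exp_ofReal_mul_I]
  refine Matrix.mem_specialUnitaryGroup_iff.mpr ⟨?_, ?_⟩
  · rw [Matrix.mem_unitaryGroup_iff, star_smul, star_one, Matrix.smul_mul, Matrix.one_mul, smul_smul,
      Complex.star_def, Complex.mul_conj, Complex.normSq_eq_norm_sq, hζ1, one_pow, Complex.ofReal_one, one_smul]
  · rw [Matrix.det_smul, Matrix.det_one, mul_one, Fintype.card_fin, hζ, ← Complex.exp_nat_mul]
    have hNr : (0 : ℝ) < N := by exact_mod_cast hN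
    have hr : (N : ℝ) * (2 * Real.pi * k / N) = k * (2 * Real.pi) := by
      rw [← mul_div_assoc, mul_div_cancel_left₀ _ hNr.ne']; ring
    have h1 : (N : ℂ) * ((((2 * Real.pi * k / N : ℝ)) : ℂ) * I) = (k : ℕ) * (2 * Real.pi * I) := by
      calc (N : ℂ) * ((((2 * Real.pi * k / N : ℝ)) : ℂ) * I)
          = (((N : ℝ) * (2 * Real.pi * k / N) : ℝ) : ℂ) * I := by push_cast; ring
        _ = (((k : ℝ) * (2 * Real.pi) : ℝ) : ℂ) * I := by rw [hr]
        _ = (k : ℕ) * (2 * Real.pi * I) := by push_cast; ring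
    rw [h1, Complex.exp_nat_mul_two_pi_mul_I]

/-- ★★ **FOR EVEN `N ≥ 2` THE RADIUS `√N·π` IS ATTAINED**: the central element `−1 = e^{2πi(N/2)/N}·1 ∈ SU(N)` has NO logarithm in the chart
of Hilbert–Schmidt norm `< √N·π` (§3 with `k = N/2`: `k(N−k)/N = N/4`).  With §2 the covering radius `sup_U inf {‖v‖ : expPtSU v = U}` of the
trace-free exponential chart is EXACTLY `√N·π` for even `N`. [folklore] -/
theorem exists_forall_expPtSU_eq_sqrt_mul_pi_le_norm (hN : 0 < N) (heven : Even N) :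
    ∃ U : SUN N, ∀ v : ChartSU N, expPtSU v = U → Real.sqrt N * Real.pi ≤ ‖v‖ := by
  obtain ⟨k, hk⟩ := heven
  refine ⟨⟨_, centre_mem_specialUnitaryGroup hN k⟩, fun v hv => ?_⟩
  have h := sq_norm_ge_of_expPtSU_eq_centre hN (k := k) (v := v) (by rw [hv])
  have hkk : ((k : ℝ) * (N - k) / N) = N / 4 := by
    have hNr : (N : ℝ) = k + k := by exact_mod_cast hk
    have hNpos : (0 : ℝ) < N := by exact_mod_cast hN
    rw [hNr] at hNpos ⊢
    field_simp
    ring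
  rw [hkk] at h
  have h0 : 0 ≤ Real.sqrt N * Real.pi := by positivity
  have hlhs : (Real.sqrt N * Real.pi) ^ 2 = N * Real.pi ^ 2 := by rw [mul_pow, Real.sq_sqrt (Nat.cast_nonneg N)]
  refine (pow_le_pow_iff_left₀ h0 (norm_nonneg v) two_ne_zero).mp ?_
  rw [hlhs]
  nlinarith [h, Real.pi_pos]

/-- … hence for even `N ≥ 2` NO window of radius `S < √N·π` is the whole group (file 19's `expBallSU_eq_univ_of_le` and §2's
`expBallSU_sqrt_mul_pi_eq_univ` are sharp there). [folklore] -/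
theorem expBallSU_ne_univ_of_lt_sqrt_mul_pi (hN : 0 < N) (heven : Even N) {S : ℝ} (hS : S < Real.sqrt N * Real.pi) :
    expBallSU (N := N) S ≠ univ := by
  obtain ⟨U, hU⟩ := exists_forall_expPtSU_eq_sqrt_mul_pi_le_norm hN heven
  intro h
  have hmem : U ∈ expBallSU (N := N) S := h ▸ mem_univ U
  obtain ⟨v, hv, hvU⟩ := hmem
  have := hU v hvU
  have hv' := mem_closedBall_zero_iff.mp hv
  linarith

end Centre

end Summit.QuantumFields.YangMills.Theorems.N21ExpChartCoveringRadius

end
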